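import Mathlib
import Summits.Ventures.HodgeRepro.Tier4.Line1.SigmaCompactGA
import Summits.Ventures.HodgeRepro.Tier4.Line4.TorusProduct
import Summits.Ventures.HodgeRepro.Tier4.Line4.FinitePartClosed
import Summits.Ventures.HodgeRepro.Tier4.Common.HaarProductTransport

/-!
# Tier4/Line4/TorusProductHaar — C-L4-TORUSPROD (5)–(7): the Haar measure of the adelic torus along `torusSplit`

Blind re-derivation cell `pub-hodge-repro`, Tier 4 «PROVE THE STEP» (README §9–§10), LINE L4, seat t4-L2-p1 g2 on
t4-plan-4 g3's cut C-L4-TORUSPROD (S14382 / S14416 / S14521; statements VERBATIM from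
proofs/t4-plan-4/work/TorusProduct-STATEMENTS-v2.lean, (5)–(7) and their `T′` twins).  Companion of
`Tier4/Line4/TorusProduct.lean` (Parts 0–1: the splittings `torusSplit`, `torusSplit'`).

* The four factor tori `T_∞`, `T_f`, `T′_∞`, `T′_f` are second countable (subspaces of the second countable tori,
  `Line1.secondCountable_torusT(')`) and locally compact (closed in the locally compact tori, `Line1.locallyCompact_torusT(')`;
  closedness = L4-p2's `isClosed_subgroupOf_infinitePart` / `isClosed_subgroupOf_finitePart` of FinitePartClosed, by name).
* **(5)** the transported product of Haar measures is Haar, **(6)** Haar uniqueness `μT = c • map (torusSplit).symm (νinf ⊗ νf)`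
  with `c > 0`, **(7)** the iterated integral `∫_{T(𝔸)} F dμT = c ∫_{T_∞} ∫_{T_f} F(a b) dνf dνinf` — each is typer-1's generic
  `Common.isHaarMeasure_map_symm_prod` / `exists_smul_map_symm_prod_eq` / `integral_eq_smul_integral_prod`
  (HaarProductTransport p694668) at `e := torusSplit W`, resp. `torusSplit' W`, consumed by name; nothing generic is restated.

Nothing here asserts the wall; the factorisation cuts downstream (PRODINT, INNERSPLIT, FINSUM, WFIBRE / W0REL) consume
these by name.  No printed input.  Nothing here says anything about the status of the Hodge conjecture for CM abelian
varieties, which is NOT proved (HC_CM is NOT proved by anyone in this repository).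
-/

set_option autoImplicit false

noncomputable section

namespace Summit.Ventures.HodgeRepro.Tier4.Line4

open MeasureTheory
open Summit.Ventures.HodgeRepro.Tier4 Summit.Ventures.HodgeRepro.Tier4.Common Summit.Ventures.HodgeRepro.Tier4.Line1

open scoped Topology NNReal

variable {k : Type} [Field k] [NumberField k] (W : PlaneData k)

/-! ## The factor tori are locally compact and second countable; the Haar half on `T(𝔸)` -/

/-- `T_∞` is second countable (subspace of the second countable `T(𝔸)`, `Line1.secondCountable_torusT`). -/
theorem secondCountable_torusInf : SecondCountableTopology (torusInf W) := by
  haveI := secondCountable_torusT W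
  exact Topology.IsEmbedding.subtypeVal.secondCountableTopology

/-- `T_f` is second countable. -/
theorem secondCountable_torusFin : SecondCountableTopology (torusFin W) := by
  haveI := secondCountable_torusT W
  exact Topology.IsEmbedding.subtypeVal.secondCountableTopology

/-- `T_∞` is locally compact: closed in the locally compact `T(𝔸)` (closedness = L4-p2's
`isClosed_subgroupOf_infinitePart` at `H := torusT W`, consumed by name). -/
theorem locallyCompact_torusInf : LocallyCompactSpace (torusInf W) := by
  haveI := locallyCompact_torusT W
  exact (isClosed_subgroupOf_infinitePart W (torusT W)).locallyCompactSpace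

/-- `T_f` is locally compact: closed in the locally compact `T(𝔸)` (closedness = L4-p2's
`isClosed_subgroupOf_finitePart` at `H := torusT W`, consumed by name). -/
theorem locallyCompact_torusFin : LocallyCompactSpace (torusFin W) := by
  haveI := locallyCompact_torusT W
  exact (isClosed_subgroupOf_finitePart W (torusT W)).locallyCompactSpace

section Measure

variable [MeasurableSpace (torusT W)] [BorelSpace (torusT W)]

/-- (5) the product of Haar measures on `T_∞`, `T_f`, transported along the splitting, is a Haar measure on `T(𝔸)`
(typer-1's generic `Common.isHaarMeasure_map_symm_prod` at `e := torusSplit W`, consumed by name). -/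
theorem isHaarMeasure_map_torusSplit_symm_prod
    (νinf : Measure (torusInf W)) [νinf.IsHaarMeasure] (νf : Measure (torusFin W)) [νf.IsHaarMeasure] :
    (Measure.map (torusSplit W).symm (νinf.prod νf)).IsHaarMeasure := by
  haveI := secondCountable_torusInf W
  haveI := secondCountable_torusFin W
  haveI := locallyCompact_torusInf W
  haveI := locallyCompact_torusFin W
  exact Summit.Ventures.HodgeRepro.Tier4.Common.isHaarMeasure_map_symm_prod (torusSplit W) νinf νf

/-- **HAAR UNIQUENESS ON THE TORUS** (cut C-L4-TORUSPROD (6)): any Haar measure `μT` on `T(𝔸)` is a positive multiple of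
the transported product (`T(𝔸)` locally compact and second countable as a closed subgroup of `G(𝔸)`; typer-1's generic
`Common.exists_smul_map_symm_prod_eq` at `e := torusSplit W`). -/
theorem exists_smul_map_prod_eq (μT : Measure (torusT W)) [μT.IsHaarMeasure]
    (νinf : Measure (torusInf W)) [νinf.IsHaarMeasure] (νf : Measure (torusFin W)) [νf.IsHaarMeasure] :
    ∃ c : ℝ≥0, 0 < c ∧ μT = c • Measure.map (torusSplit W).symm (νinf.prod νf) := by
  haveI := locallyCompact_torusT W
  haveI := secondCountable_torusT W
  haveI := secondCountable_torusInf W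
  haveI := secondCountable_torusFin W
  haveI := locallyCompact_torusInf W
  haveI := locallyCompact_torusFin W
  exact Summit.Ventures.HodgeRepro.Tier4.Common.exists_smul_map_symm_prod_eq (torusSplit W) μT νinf νf

/-- **THE TORUS INTEGRAL AS AN ITERATED `T_∞ × T_f` INTEGRAL** (cut C-L4-TORUSPROD (7)): for `μT = c • (νinf ⊗ νf)` and an
integrable `F`, `∫_{T(𝔸)} F dμT = c ∫_{T_∞} ∫_{T_f} F(a b) dνf dνinf` (typer-1's generic
`Common.integral_eq_smul_integral_prod` at `e := torusSplit W`; `(torusSplit W).symm (a, b) = a * b` by definition). -/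
theorem integral_eq_smul_integral_prod (μT : Measure (torusT W)) [μT.IsHaarMeasure]
    (νinf : Measure (torusInf W)) [νinf.IsHaarMeasure] (νf : Measure (torusFin W)) [νf.IsHaarMeasure]
    (c : ℝ≥0) (hc : μT = c • Measure.map (torusSplit W).symm (νinf.prod νf))
    (F : torusT W → ℂ) (hF : Integrable F μT) :
    ∫ t, F t ∂μT = (c : ℝ) • ∫ a, ∫ b, F ((a : torusT W) * (b : torusT W)) ∂νf ∂νinf := by
  haveI := secondCountable_torusInf W
  haveI := secondCountable_torusFin W
  haveI := locallyCompact_torusInf W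
  haveI := locallyCompact_torusFin W
  exact Summit.Ventures.HodgeRepro.Tier4.Common.integral_eq_smul_integral_prod (torusSplit W) μT νinf νf c hc F hF

end Measure

/-! ## The `T′` twins -/

/-- `T′_∞` is second countable (subspace of the second countable `T′(𝔸)`, `Line1.secondCountable_torusT'`). -/
theorem secondCountable_torusInf' : SecondCountableTopology (torusInf' W) := by
  haveI := secondCountable_torusT' W
  exact Topology.IsEmbedding.subtypeVal.secondCountableTopology

/-- `T′_f` is second countable. -/
theorem secondCountable_torusFin' : SecondCountableTopology (torusFin' W) := by
  haveI := secondCountable_torusT' W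
  exact Topology.IsEmbedding.subtypeVal.secondCountableTopology

/-- `T′_∞` is locally compact: closed in the locally compact `T′(𝔸)` (closedness = L4-p2's
`isClosed_subgroupOf_infinitePart` at `H := torusT' W`, consumed by name). -/
theorem locallyCompact_torusInf' : LocallyCompactSpace (torusInf' W) := by
  haveI := locallyCompact_torusT' W
  exact (isClosed_subgroupOf_infinitePart W (torusT' W)).locallyCompactSpace

/-- `T′_f` is locally compact: closed in the locally compact `T′(𝔸)` (closedness = L4-p2's
`isClosed_subgroupOf_finitePart` at `H := torusT' W`, consumed by name). -/
theorem locallyCompact_torusFin' : LocallyCompactSpace (torusFin' W) := by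
  haveI := locallyCompact_torusT' W
  exact (isClosed_subgroupOf_finitePart W (torusT' W)).locallyCompactSpace

section Measure'

variable [MeasurableSpace (torusT' W)] [BorelSpace (torusT' W)]

/-- (5) the product of Haar measures on `T′_∞`, `T′_f`, transported along the splitting, is a Haar measure on `T′(𝔸)`
(typer-1's generic `Common.isHaarMeasure_map_symm_prod` at `e := torusSplit' W`, consumed by name). -/
theorem isHaarMeasure_map_torusSplit'_symm_prod
    (νinf : Measure (torusInf' W)) [νinf.IsHaarMeasure] (νf : Measure (torusFin' W)) [νf.IsHaarMeasure] :
    (Measure.map (torusSplit' W).symm (νinf.prod νf)).IsHaarMeasure := by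
  haveI := secondCountable_torusInf' W
  haveI := secondCountable_torusFin' W
  haveI := locallyCompact_torusInf' W
  haveI := locallyCompact_torusFin' W
  exact Summit.Ventures.HodgeRepro.Tier4.Common.isHaarMeasure_map_symm_prod (torusSplit' W) νinf νf

/-- **HAAR UNIQUENESS ON THE TORUS** (cut C-L4-TORUSPROD (6)): any Haar measure `μT'` on `T′(𝔸)` is a positive multiple of
the transported product (`T′(𝔸)` locally compact and second countable as a closed subgroup of `G(𝔸)`; typer-1's generic
`Common.exists_smul_map_symm_prod_eq` at `e := torusSplit' W`). -/
theorem exists_smul_map_prod_eq' (μT' : Measure (torusT' W)) [μT'.IsHaarMeasure]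
    (νinf : Measure (torusInf' W)) [νinf.IsHaarMeasure] (νf : Measure (torusFin' W)) [νf.IsHaarMeasure] :
    ∃ c : ℝ≥0, 0 < c ∧ μT' = c • Measure.map (torusSplit' W).symm (νinf.prod νf) := by
  haveI := locallyCompact_torusT' W
  haveI := secondCountable_torusT' W
  haveI := secondCountable_torusInf' W
  haveI := secondCountable_torusFin' W
  haveI := locallyCompact_torusInf' W
  haveI := locallyCompact_torusFin' W
  exact Summit.Ventures.HodgeRepro.Tier4.Common.exists_smul_map_symm_prod_eq (torusSplit' W) μT' νinf νf

/-- **THE TORUS INTEGRAL AS AN ITERATED `T′_∞ × T′_f` INTEGRAL** (cut C-L4-TORUSPROD (7)): for `μT' = c • (νinf ⊗ νf)` and an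
integrable `F`, `∫_{T′(𝔸)} F dμT' = c ∫_{T′_∞} ∫_{T′_f} F(a b) dνf dνinf` (typer-1's generic
`Common.integral_eq_smul_integral_prod` at `e := torusSplit' W`; `(torusSplit' W).symm (a, b) = a * b` by definition). -/
theorem integral_eq_smul_integral_prod' (μT' : Measure (torusT' W)) [μT'.IsHaarMeasure]
    (νinf : Measure (torusInf' W)) [νinf.IsHaarMeasure] (νf : Measure (torusFin' W)) [νf.IsHaarMeasure]
    (c : ℝ≥0) (hc : μT' = c • Measure.map (torusSplit' W).symm (νinf.prod νf))
    (F : torusT' W → ℂ) (hF : Integrable F μT') :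
    ∫ t, F t ∂μT' = (c : ℝ) • ∫ a, ∫ b, F ((a : torusT' W) * (b : torusT' W)) ∂νf ∂νinf := by
  haveI := secondCountable_torusInf' W
  haveI := secondCountable_torusFin' W
  haveI := locallyCompact_torusInf' W
  haveI := locallyCompact_torusFin' W
  exact Summit.Ventures.HodgeRepro.Tier4.Common.integral_eq_smul_integral_prod (torusSplit' W) μT' νinf νf c hc F hF

end Measure'

end Summit.Ventures.HodgeRepro.Tier4.Line4
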